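import Literature.NumberTheory.LFunctions.DeBruijnPhiDecreasing
import Literature.NumberTheory.LFunctions.XiMoments
import Literature.Analysis.ValidatedNumerics.MonotoneQuadrature
import HarnessLib

/-!
# Validated point enclosures of the Pólya–de Bruijn kernel `Φ` (for the Turán inequality of `Ξ`)

Source context: Wang–Yang, Trans. AMS **377** (2024), Conjecture 1.10, refuted in
`CompleteMonotonicity.lean` (this directory) CONDITIONALLY on the named fact `TuranInequalities`
(Csordas–Norfolk–Varga 1986, Thm. 2.5); the refutation uses only its instance `m = 2`,
`(3/5)·b₁·b₃ < b₂²` with `b_m = ∫₀^∞ u^{2m} Φ(u) du = xiMoment (2m)`.  This module and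
`TuranCertificate.lean` make that instance a KERNEL-CHECKED theorem, by the validated monotone
quadrature of `Literature/Analysis/ValidatedNumerics/MonotoneQuadrature.lean` (Moore 1966,
Ch. 3, 8) applied to `Φ = deBruijnPhi`, which is positive and strictly decreasing on `[0, ∞)`
(`deBruijnPhi_pos_of_nonneg`, `strictAntiOn_deBruijnPhi`, already in the tree).

Contents (no new mathematics; [folklore] numerics):
* `majorant_add_two_le`, `tsum_majorant_add_two_le` (`∑_{n ≥ 2} M n ≤ 1/4096`),
  `tsum_majorant_le` (`∑ M n ≤ 50`) — numeric bounds for the tree's termwise majorant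
  `deBruijnPhiMajorant`; hence the two-term sandwich
  `Φ₀(u) + Φ₁(u) ≤ Φ(u) ≤ Φ₀(u) + Φ₁(u) + e^{9u − πe^{4u}}/4096` (`two_le_deBruijnPhi`,
  `deBruijnPhi_le_two`) and `Φ(u) ≤ 50·e^{9u − πe^{4u}}` on `u ≥ 0`;
* `antitoneMoment_deBruijnPhi` — the hypotheses of the monotone quadrature (the tail beyond
  `u = 1` is bounded in `TuranCertificate.lean`);
* the point ORACLE `PhiCert.PhiPt kE kG kW q i : Option MI` — an enclosure of `Φ(i/q)` at the
  binary scale `2^40` in the exact-integer interval arithmetic `MI` of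
  `Literature/Analysis/ValidatedNumerics/MultiPrecisionInterval.lean` (four `MI.expPt` calls per
  point: `e^{4u}`, `e^{−4u}`, `e^{9u − πe^{4u}}`, `e^{−3πe^{4u}}`; `π` by a checked literal
  enclosure), with its soundness theorem `PhiCert.mem_PhiPt` in the shape
  `encl_of_checkBlock₃` wants.
-/

open Real Set MeasureTheory
open Literature.Analysis.ValidatedNumerics.NumericsMP
open Literature.Analysis.ValidatedNumerics.MonotoneQuadrature

namespace Literature.NumberTheory.LFunctions.WangYang2024

/-! ## Numeric bounds for the majorant series -/

/-- `e^{−13} ≤ 0.3678794412^{13}` and friends: `exp (-(n:ℕ)) ≤ 0.3678794412 ^ n`. [folklore] -/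
theorem exp_neg_nat_le (n : ℕ) : Real.exp (-(n : ℝ)) ≤ (0.3678794412 : ℝ) ^ n := by
  have h1 : Real.exp (-(n : ℝ)) = Real.exp (-1) ^ n := by
    rw [← Real.exp_nat_mul]; ring_nf
  rw [h1]
  exact pow_le_pow_left₀ (Real.exp_pos _).le Real.exp_neg_one_lt_d9.le n

/-- `m⁴ ≤ e^{4m}` for `m ≥ 0`. [folklore] -/
theorem pow_four_le_exp {m : ℝ} (hm : 0 ≤ m) : m ^ 4 ≤ Real.exp (4 * m) := by
  have h := sq_le_exp_two_mul hm
  have h2 : (m ^ 2) ^ 2 ≤ (Real.exp (2 * m)) ^ 2 := pow_le_pow_left₀ (sq_nonneg m) h 2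
  have e1 : (m ^ 2) ^ 2 = m ^ 4 := by ring
  have e2 : (Real.exp (2 * m)) ^ 2 = Real.exp (4 * m) := by
    rw [← Real.exp_nat_mul]; ring_nf
  rw [e1, e2] at h2
  exact h2

/-- The majorant tail terms: `M (i+2) ≤ (1/8192)·(1/2)^i`. [folklore] -/
theorem majorant_add_two_le (i : ℕ) :
    deBruijnPhiMajorant (i + 2) ≤ (1 / 8192 : ℝ) * (1 / 2) ^ i := by
  unfold deBruijnPhiMajorant
  have hi : (0 : ℝ) ≤ i := Nat.cast_nonneg i
  set m : ℝ := ((i + 2 : ℕ) : ℝ) + 1 with hm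
  have hm3 : m = (i : ℝ) + 3 := by rw [hm]; push_cast; ring
  have hm0 : 0 ≤ m := by rw [hm3]; linarith
  have hpi := Real.pi_gt_d2
  have hpi' := Real.pi_lt_d4
  -- m⁴ ≤ e^{4m}
  have h4 := pow_four_le_exp hm0
  -- exponent bound: π + 4m − πm² ≤ −13 − 14 i
  have hexp : π + 4 * m - π * m ^ 2 ≤ -13 - 14 * i := by
    rw [hm3]
    nlinarith [sq_nonneg (i : ℝ), mul_nonneg hi hi, hpi, mul_nonneg (sub_nonneg.2 hpi.le) hi,
      mul_nonneg (sub_nonneg.2 hpi.le) (mul_nonneg hi hi)]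
  have hA : m ^ 4 * (Real.exp π * Real.exp (-(π * m ^ 2)))
      ≤ Real.exp (-13) * Real.exp (-14) ^ i := by
    calc m ^ 4 * (Real.exp π * Real.exp (-(π * m ^ 2)))
        ≤ Real.exp (4 * m) * (Real.exp π * Real.exp (-(π * m ^ 2))) :=
          mul_le_mul_of_nonneg_right h4 (by positivity)
      _ = Real.exp (π + 4 * m - π * m ^ 2) := by
          rw [← Real.exp_add, ← Real.exp_add]; ring_nf
      _ ≤ Real.exp (-13 - 14 * i) := Real.exp_le_exp.2 hexp
      _ = Real.exp (-13) * Real.exp (-14) ^ i := by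
          rw [← Real.exp_nat_mul, ← Real.exp_add]; ring_nf
  have h13 : Real.exp (-13) ≤ (0.3678794412 : ℝ) ^ 13 := by
    simpa using exp_neg_nat_le 13
  have h14 : Real.exp (-14) ≤ 1 / 2 := by
    have := exp_neg_nat_le 14
    norm_num at this
    exact this.trans (by norm_num)
  have h14i : Real.exp (-14) ^ i ≤ (1 / 2 : ℝ) ^ i :=
    pow_le_pow_left₀ (Real.exp_pos _).le h14 i
  have hpi2 : π ^ 2 ≤ 9.87 := by nlinarith
  calc 5 * π ^ 2 * m ^ 4 * (Real.exp π * Real.exp (-(π * m ^ 2)))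
      = 5 * π ^ 2 * (m ^ 4 * (Real.exp π * Real.exp (-(π * m ^ 2)))) := by ring
    _ ≤ 5 * 9.87 * (((0.3678794412 : ℝ) ^ 13) * (1 / 2 : ℝ) ^ i) := by
        apply mul_le_mul (by nlinarith) (hA.trans (mul_le_mul h13 h14i (by positivity)
          (by positivity))) (by positivity) (by positivity)
    _ ≤ (1 / 8192 : ℝ) * (1 / 2) ^ i := by
        rw [← mul_assoc]
        apply mul_le_mul_of_nonneg_right _ (by positivity)
        norm_num

/-- Summability of the shifted majorant. [folklore] -/
theorem summable_majorant_add_two : Summable fun i => deBruijnPhiMajorant (i + 2) :=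
  (summable_nat_add_iff 2).2 summable_deBruijnPhiMajorant

/-- `∑_{n ≥ 2} M n ≤ 1/4096`. [folklore] -/
theorem tsum_majorant_add_two_le : ∑' i, deBruijnPhiMajorant (i + 2) ≤ 1 / 4096 := by
  have hg : Summable fun i : ℕ => (1 / 8192 : ℝ) * (1 / 2) ^ i :=
    (summable_geometric_of_lt_one (by norm_num) (by norm_num)).mul_left _
  calc ∑' i, deBruijnPhiMajorant (i + 2) ≤ ∑' i : ℕ, (1 / 8192 : ℝ) * (1 / 2) ^ i :=
        Summable.tsum_le_tsum majorant_add_two_le summable_majorant_add_two hg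
    _ = (1 / 8192 : ℝ) * ∑' i : ℕ, (1 / 2 : ℝ) ^ i := tsum_mul_left
    _ = 1 / 4096 := by
        rw [tsum_geometric_of_lt_one (by norm_num) (by norm_num)]; norm_num

/-- `∑ M n ≤ 50` (`M 0 = 5π²`, `M 1 = 80π² e^{−3π}`, the rest `≤ 1/4096`). [folklore] -/
theorem tsum_majorant_le : ∑' n, deBruijnPhiMajorant n ≤ 50 := by
  rw [← summable_deBruijnPhiMajorant.sum_add_tsum_nat_add 2]
  have hpi := Real.pi_gt_d2
  have hpi' := Real.pi_lt_d4
  have h0 : deBruijnPhiMajorant 0 = 5 * π ^ 2 := by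
    unfold deBruijnPhiMajorant
    rw [← Real.exp_add]; norm_num
  have h1 : deBruijnPhiMajorant 1 ≤ 1 / 8 := by
    unfold deBruijnPhiMajorant
    have e : Real.exp π * Real.exp (-(π * (((1 : ℕ) : ℝ) + 1) ^ 2)) = Real.exp (-(3 * π)) := by
      rw [← Real.exp_add]; norm_num; ring_nf
    rw [e]
    have h9 : Real.exp (-(3 * π)) ≤ Real.exp (-9) := Real.exp_le_exp.2 (by linarith)
    have h9' : Real.exp (-9) ≤ (0.3678794412 : ℝ) ^ 9 := by simpa using exp_neg_nat_le 9
    have hpi2 : π ^ 2 ≤ 9.87 := by nlinarith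
    calc 5 * π ^ 2 * (((1 : ℕ) : ℝ) + 1) ^ 4 * Real.exp (-(3 * π))
        ≤ 5 * 9.87 * 16 * (0.3678794412 : ℝ) ^ 9 := by
          norm_num
          nlinarith [h9.trans h9', Real.exp_pos (-(3 * π))]
      _ ≤ 1 / 8 := by norm_num
  rw [Finset.sum_range_succ, Finset.sum_range_one, h0]
  have hpi2 : π ^ 2 ≤ 9.87 := by nlinarith
  linarith [tsum_majorant_add_two_le]

/-! ## The two-term sandwich and the global bound for `Φ` on `[0, ∞)` -/

/-- Lower side: `Φ₀(u) + Φ₁(u) ≤ Φ(u)` for `u ≥ 0` (all summands positive). [folklore] -/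
theorem two_le_deBruijnPhi {u : ℝ} (hu : 0 ≤ u) :
    deBruijnPhiSummand 0 u + deBruijnPhiSummand 1 u ≤ deBruijnPhi u := by
  have h := (summable_deBruijnPhi_holds u).sum_le_tsum (Finset.range 2)
    (fun n _ => (deBruijnPhiSummand_pos n hu).le)
  simpa [Finset.sum_range_succ, deBruijnPhi] using h

/-- Upper side: `Φ(u) ≤ Φ₀(u) + Φ₁(u) + e^{9u − πe^{4u}}/4096` for `u ≥ 0`. [folklore] -/
theorem deBruijnPhi_le_two {u : ℝ} (hu : 0 ≤ u) :
    deBruijnPhi u ≤ deBruijnPhiSummand 0 u + deBruijnPhiSummand 1 u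
      + Real.exp (9 * u - π * Real.exp (4 * u)) / 4096 := by
  have hs := summable_deBruijnPhi_holds u
  rw [deBruijnPhi, ← hs.sum_add_tsum_nat_add 2, Finset.sum_range_succ, Finset.sum_range_one]
  have hs2 : Summable fun i => deBruijnPhiSummand (i + 2) u := (summable_nat_add_iff 2).2 hs
  have ht : ∑' i, deBruijnPhiSummand (i + 2) u
      ≤ ∑' i, deBruijnPhiMajorant (i + 2) * Real.exp (9 * u - π * Real.exp (4 * u)) :=
    Summable.tsum_le_tsum (fun i => (le_abs_self _).trans (abs_deBruijnPhiSummand_le (i + 2) hu))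
      hs2 (summable_majorant_add_two.mul_right _)
  rw [tsum_mul_right] at ht
  have hE := Real.exp_pos (9 * u - π * Real.exp (4 * u))
  have := mul_le_mul_of_nonneg_right tsum_majorant_add_two_le hE.le
  linarith

/-- `Φ(u) ≤ 50·e^{9u − πe^{4u}}` for `u ≥ 0`. [folklore] -/
theorem deBruijnPhi_le_fifty {u : ℝ} (hu : 0 ≤ u) :
    deBruijnPhi u ≤ 50 * Real.exp (9 * u - π * Real.exp (4 * u)) :=
  ((le_abs_self _).trans (abs_deBruijnPhi_le hu)).trans
    (mul_le_mul_of_nonneg_right tsum_majorant_le (Real.exp_pos _).le)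

/-! ## Monotone-quadrature hypotheses -/

/-- `Φ` is antitone, nonnegative and has integrable moments on `[0, ∞)`. [folklore] -/
theorem antitoneMoment_deBruijnPhi (n : ℕ) : AntitoneMoment deBruijnPhi n where
  anti := strictAntiOn_deBruijnPhi.antitoneOn
  nonneg := fun t ht => (deBruijnPhi_pos_of_nonneg ht).le
  integrable := by
    have e : (fun t : ℝ => t ^ n * deBruijnPhi t) = fun u => deBruijnPhi u * u ^ n :=
      funext fun _ => mul_comm _ _
    rw [e]
    exact integrableOn_deBruijnPhi_mul_pow n

/-! ## The point oracle -/

namespace PhiCert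

/-- The binary scale `2^40` of the point enclosures. [folklore] -/
def SC : ℕ := 1099511627776

/-- A literal enclosure of `π` at scale `2^40`: `⌊π·2^40⌋ = 3454217652357`. [folklore] -/
def PI : MI := ⟨3454217652357, 3454217652358⟩

/-- `π ∈ PI` (from the 20-digit bounds on `π`). [folklore] -/
theorem mem_PI : MI.mem SC Real.pi PI := by
  rw [MI.mem_def]
  have h1 := Real.pi_gt_d20
  have h2 := Real.pi_lt_d20
  simp only [PI, SC]
  push_cast
  constructor <;> nlinarith

/-- The core arithmetic of the oracle, given enclosures `H9 ∋ e^{9u−πx}`, `Ei ∋ e^{−4u}`,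
`W ∋ e^{−3πx}` (`x = e^{4u}`): the two-term sandwich
`[lo(Φ₀+Φ₁), hi(Φ₀+Φ₁+H9/4096)]`, `Φ₀ = 2π²e^{9u−πx} − 3πe^{5u−πx}`,
`Φ₁ = 32π²e^{9u−4πx} − 12πe^{5u−4πx}`. [folklore] -/
def phiCore (H9 Ei W : MI) : MI :=
  let H5 := MI.mul SC H9 Ei
  let G9 := MI.mul SC H9 W
  let G5 := MI.mul SC H5 W
  let P2 := MI.sqr SC PI
  let T0 := MI.sub (MI.mulInt (MI.mul SC P2 H9) 2) (MI.mulInt (MI.mul SC PI H5) 3)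
  let T1 := MI.sub (MI.mulInt (MI.mul SC P2 G9) 32) (MI.mulInt (MI.mul SC PI G5) 12)
  let T := MI.add T0 T1
  MI.span T (MI.add T (MI.divNat H9 4096))

/-- The Option plumbing of the point oracle, over abstract `exp` enclosure maps `fE`, `fG`, `fW`
(so that the soundness proof never unfolds the interval exponential). [folklore] -/
def phiOpt (fE fG fW : MI → Option MI) (q i : ℕ) : Option MI :=
  match fE (MI.ofFrac SC (4 * (i : ℤ)) q) with
  | none => none
  | some E4 =>
    match fE (MI.ofFrac SC (-(4 * (i : ℤ))) q) with
    | none => none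
    | some Ei =>
      match fG (MI.sub (MI.ofFrac SC (9 * (i : ℤ)) q) (MI.mul SC PI E4)) with
      | none => none
      | some H9 =>
        match fW (MI.neg (MI.mulInt (MI.mul SC PI E4) 3)) with
        | none => none
        | some W => some (phiCore H9 Ei W)

/-- The point oracle: an enclosure of `Φ(i/q)` at scale `SC` (`kE`, `kG`, `kW` = numbers of
argument halvings in the three kinds of `exp` calls, each with 10 Taylor terms; `none` on a range
failure). [folklore] -/
def PhiPt (kE kG kW q i : ℕ) : Option MI :=
  phiOpt (MI.expPt SC 10 kE) (MI.expPt SC 10 kG) (MI.expPt SC 10 kW) q i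

/-- The algebra of the first summand: `Φ₀(u) = 2π²h₉ − 3πh₉e^{−4u}`, `h₉ = e^{9u−πe^{4u}}`.
[folklore] -/
theorem summand_zero_eq (u : ℝ) : deBruijnPhiSummand 0 u =
    π ^ 2 * Real.exp (9 * u - π * Real.exp (4 * u)) * ((2 : ℤ) : ℝ)
      - π * (Real.exp (9 * u - π * Real.exp (4 * u)) * Real.exp (-(4 * u))) * ((3 : ℤ) : ℝ) := by
  unfold deBruijnPhiSummand
  have e1 : Real.exp (9 * u - π * Real.exp (4 * u))
      = Real.exp (9 * u) * Real.exp (-(π * (((0 : ℕ) : ℝ) + 1) ^ 2 * Real.exp (4 * u))) := by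
    simp only [← Real.exp_add]; congr 1; push_cast; ring
  have e2 : Real.exp (9 * u - π * Real.exp (4 * u)) * Real.exp (-(4 * u))
      = Real.exp (5 * u) * Real.exp (-(π * (((0 : ℕ) : ℝ) + 1) ^ 2 * Real.exp (4 * u))) := by
    simp only [← Real.exp_add]; congr 1; push_cast; ring
  rw [e2, e1]; push_cast; ring

/-- The algebra of the second summand: `Φ₁(u) = 32π²h₉w − 12πh₉e^{−4u}w`, `w = e^{−3πe^{4u}}`.
[folklore] -/
theorem summand_one_eq (u : ℝ) : deBruijnPhiSummand 1 u =
    π ^ 2 * (Real.exp (9 * u - π * Real.exp (4 * u))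
        * Real.exp (-(π * Real.exp (4 * u) * ((3 : ℤ) : ℝ)))) * ((32 : ℤ) : ℝ)
      - π * (Real.exp (9 * u - π * Real.exp (4 * u)) * Real.exp (-(4 * u))
          * Real.exp (-(π * Real.exp (4 * u) * ((3 : ℤ) : ℝ)))) * ((12 : ℤ) : ℝ) := by
  unfold deBruijnPhiSummand
  have e1 : Real.exp (9 * u - π * Real.exp (4 * u))
      * Real.exp (-(π * Real.exp (4 * u) * ((3 : ℤ) : ℝ)))
      = Real.exp (9 * u) * Real.exp (-(π * (((1 : ℕ) : ℝ) + 1) ^ 2 * Real.exp (4 * u))) := by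
    simp only [← Real.exp_add]; congr 1; push_cast; ring
  have e2 : Real.exp (9 * u - π * Real.exp (4 * u)) * Real.exp (-(4 * u))
      * Real.exp (-(π * Real.exp (4 * u) * ((3 : ℤ) : ℝ)))
      = Real.exp (5 * u) * Real.exp (-(π * (((1 : ℕ) : ℝ) + 1) ^ 2 * Real.exp (4 * u))) := by
    simp only [← Real.exp_add]; congr 1; push_cast; ring
  rw [e2, e1]; push_cast; ring

/-- Soundness of the core: from sound inputs, `Φ(u) ∈ phiCore H9 Ei W` (`u ≥ 0`). [folklore] -/
theorem mem_phiCore {u : ℝ} (hu : 0 ≤ u) {H9 Ei W : MI}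
    (h9 : MI.mem SC (Real.exp (9 * u - π * Real.exp (4 * u))) H9)
    (hi : MI.mem SC (Real.exp (-(4 * u))) Ei)
    (hw : MI.mem SC (Real.exp (-(π * Real.exp (4 * u) * ((3 : ℤ) : ℝ)))) W) :
    MI.mem SC (deBruijnPhi u) (phiCore H9 Ei W) := by
  have hS : 0 < SC := by decide
  unfold phiCore
  have hP := mem_PI
  have hP2 := MI.mem_sqr hS hP
  have hH5 := MI.mem_mul hS h9 hi
  have hG9 := MI.mem_mul hS h9 hw
  have hG5 := MI.mem_mul hS hH5 hw
  have hT0 := MI.mem_sub (MI.mem_mulInt (MI.mem_mul hS hP2 h9) 2)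
    (MI.mem_mulInt (MI.mem_mul hS hP hH5) 3)
  have hT1 := MI.mem_sub (MI.mem_mulInt (MI.mem_mul hS hP2 hG9) 32)
    (MI.mem_mulInt (MI.mem_mul hS hP hG5) 12)
  rw [← summand_zero_eq u] at hT0
  rw [← summand_one_eq u] at hT1
  have hT := MI.mem_add hT0 hT1
  have hR := MI.mem_divNat h9 (by norm_num : 0 < 4096)
  have hTR := MI.mem_add hT hR
  exact MI.mem_span hT hTR (two_le_deBruijnPhi hu) (by
    have := deBruijnPhi_le_two hu
    simpa [div_eq_mul_inv] using this)

/-- Soundness of the Option plumbing over sound `exp` maps: `Φ(i/q) ∈ phiOpt fE fG fW q i`.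
[folklore] -/
theorem mem_phiOpt {fE fG fW : MI → Option MI}
    (hfE : ∀ (X Y : MI) (x : ℝ), fE X = some Y → MI.mem SC x X → MI.mem SC (Real.exp x) Y)
    (hfG : ∀ (X Y : MI) (x : ℝ), fG X = some Y → MI.mem SC x X → MI.mem SC (Real.exp x) Y)
    (hfW : ∀ (X Y : MI) (x : ℝ), fW X = some Y → MI.mem SC x X → MI.mem SC (Real.exp x) Y)
    {q : ℕ} (hq : 0 < q) (i : ℕ) (E : MI) (h : phiOpt fE fG fW q i = some E) :
    MI.mem SC (deBruijnPhi ((i : ℝ) / q)) E := by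
  have hS : 0 < SC := by decide
  unfold phiOpt at h
  split at h
  · simp at h
  rename_i E4 hE4
  split at h
  · simp at h
  rename_i Ei hEi
  split at h
  · simp at h
  rename_i H9 hH9
  split at h
  · simp at h
  rename_i W hW
  simp only [Option.some.injEq] at h
  subst h
  set u : ℝ := (i : ℝ) / q with hu_def
  have hu : 0 ≤ u := by positivity
  have m4 : MI.mem SC (4 * u) (MI.ofFrac SC (4 * (i : ℤ)) q) := by
    have := MI.mem_ofFrac SC (4 * (i : ℤ)) hq
    have e : (((4 * (i : ℤ) : ℤ)) : ℝ) / (q : ℝ) = 4 * u := by rw [hu_def]; push_cast; ring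
    rwa [e] at this
  have mi4 : MI.mem SC (-(4 * u)) (MI.ofFrac SC (-(4 * (i : ℤ))) q) := by
    have := MI.mem_ofFrac SC (-(4 * (i : ℤ))) hq
    have e : (((-(4 * (i : ℤ)) : ℤ)) : ℝ) / (q : ℝ) = -(4 * u) := by rw [hu_def]; push_cast; ring
    rwa [e] at this
  have m9 : MI.mem SC (9 * u) (MI.ofFrac SC (9 * (i : ℤ)) q) := by
    have := MI.mem_ofFrac SC (9 * (i : ℤ)) hq
    have e : (((9 * (i : ℤ) : ℤ)) : ℝ) / (q : ℝ) = 9 * u := by rw [hu_def]; push_cast; ring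
    rwa [e] at this
  have hE4' := hfE _ _ _ hE4 m4
  have hEi' := hfE _ _ _ hEi mi4
  have hPx := MI.mem_mul hS mem_PI hE4'
  have hH9' := hfG _ _ _ hH9 (MI.mem_sub m9 hPx)
  have hW' := hfW _ _ _ hW (MI.mem_neg (MI.mem_mulInt hPx 3))
  exact mem_phiCore hu hH9' hEi' hW'

/-- Soundness of the point oracle: `Φ(i/q) ∈ PhiPt kE kG kW q i` (the shape
`encl_of_checkBlock₃` wants). [folklore] -/
theorem mem_PhiPt {kE kG kW q : ℕ} (hq : 0 < q) (i : ℕ) (E : MI)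
    (h : PhiPt kE kG kW q i = some E) : MI.mem SC (deBruijnPhi ((i : ℝ) / q)) E :=
  have hS : 0 < SC := by decide
  mem_phiOpt (fun _ _ _ h hx => MI.mem_expPt hS h hx) (fun _ _ _ h hx => MI.mem_expPt hS h hx)
    (fun _ _ _ h hx => MI.mem_expPt hS h hx) hq i E h

end PhiCert

end Literature.NumberTheory.LFunctions.WangYang2024
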